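import Literature.Geometry.Lorentzian.CoordCurvatureNormEvolution
import Literature.Geometry.Lorentzian.CoordShrinkerRicciLaplacian
import HarnessLib

/-!
# `Δ_f Rm = Rm + Rm ∗ Rm` and the drift inequality for `|Rm|²` on a gradient soliton (coordinates)

Continuation of `CoordShrinkerRicciLaplacian.lean` (`Δ_f Ric`) and `CoordCurvatureNormEvolution.lean`
(`Δ|Rm|² = 2⟨ΔRm, Rm⟩ + 2|∇Rm|²`): metric components `G : E → (E →L E →L ℝ)`, smooth, symmetric and
nondegenerate on an open set `V` (`IsMetricOn G V`), a smooth potential `f` with the gradient Ricci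
soliton equation `Ric + Hess f = λ G` on `V` (`λ = ½`: shrinkers). With the rough Laplacian of the
curvature endomorphism `ΔR = lapRiemAt` and the quadratic term `Q = quadRiemAt` of Topping's
Prop. 2.4.1 (`CoordCurvatureLaplacian.lean`), `∇R = covRiemAt`, `∇f = ♯Df`,
`|Rm|² = rmNormSqAt`, `Δ = lapAt`, `|∇u|² = gradSqAt`, we PROVE:

* `IsMetricOn.apply_covRiemAt_eq_of_bianchi` —
  `G((∇_v R)(X,Y)Z, W) = G(v,(∇_Y R)(Z,W)X) − G(v,(∇_X R)(Z,W)Y)` (second Bianchi identity and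
  pair symmetry of `∇R`);
* **`IsMetricOn.apply_lapRiemAt_of_soliton` — Munteanu–Wang 2015, §1, formula (id),
  `Δ_f Rm = Rm + Rm ∗ Rm` on a gradient shrinker**, here for any `λ` and with the quadratic terms
  explicit: `G((ΔR)(X,Y)Z, W) = G((∇_{∇f}R)(X,Y)Z, W) + 2λ G(R(X,Y)Z, W) + Ric(X, R(Z,W)Y)
  − Ric(Y, R(Z,W)X) − Q(X,Y,Z,W) + Q(Y,X,Z,W)` (Topping's Prop. 2.4.1 `apply_lapRiemAt`, whose four
  `∇²Ric` terms are `Hess f ∗ Rm + Df(∇R)` by `cov₃At_cov₂At_ricAt_sub_of_soliton`; then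
  `Hess f = λG − Ric` and the first item; Eminenti–La Nave–Mantegazza 2008, Prop. 2.1;
  Petersen–Wylie 2009, Lemma 2.1);
* in a `G x`-orthonormal basis `e` (`CoordCurvatureNormSq.exists_orthonormal_basis`):
  `IsMetricOn.sum_ginv_traceCLM_covRiemAt_eq` (the `∇R ∗ ∇R` contraction of `lapAt_rmNormSqAt` is
  `−|∇Rm|² = −Σ_{kacij} G((∇_{e_k}R)(e_a,e_c)e_i,e_j)²`), `IsMetricOn.fderiv_rmNormSqAt_frame`
  (`d|Rm|²(e_k) = 2⟨Rm, ∇_{e_k}Rm⟩` componentwise);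
* **`IsMetricOn.gradSqAt_rmNormSqAt_le` — Kato: `|∇|Rm|²|² ≤ 4 |Rm|² |∇Rm|²`** (Cauchy–Schwarz),
  the form of `|∇|Rm|| ≤ |∇Rm|` used in the proof of Munteanu–Wang 2015, Thm. 1.4;
* **`IsMetricOn.lapAt_rmNormSqAt_sub_fderiv_ge_of_soliton` — the drift inequality
  `Δ|Rm|² − d|Rm|²(∇f) ≥ 2|∇Rm|² + 4λ|Rm|² − (16n⁶ + 4n⁷)|Rm|³`** (Munteanu–Wang 2015, proof of
  Thm. 1.4: `Δ_f |Rm|² ≥ 2|∇Rm|² − c|Rm|³`, there combined with Kato into `Δ_f|Rm| ≥ −c|Rm|²`):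
  `Δ|Rm|² = 2⟨ΔRm,Rm⟩ + 2|∇Rm|²` and `d|Rm|²(∇f) = 2⟨∇_{∇f}Rm, Rm⟩` (`CoordCurvatureNormEvolution`),
  the second item traced against `R(e_a,e_c)`, `⟨Rm, Rm⟩`-term `= 4λ|Rm|²`, and every cubic term
  bounded in the orthonormal frame by the component estimates of `CoordCurvatureNormSq.lean`
  exactly as in `IsMetricFamilyOn.derivWithin_rmNormSqAt_le`.

Everything is proved; no definition and no statement of `Prop` type is introduced.

## References

* O. Munteanu, J. Wang, *Geometry of shrinking Ricci solitons*, Compositio Math. 151 (2015)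
  2273–2300 = arXiv:1410.3813, §1, formula (id) `Δ_f Rm = Rm + Rm ∗ Rm` (p. 3) and the proof of
  Thm. 1.4 (p. 6, Kato's inequality and `Δ_f|Rm| ≥ −c|Rm|²`). [MunteanuWang2015]
* M. Eminenti, G. La Nave, C. Mantegazza, *Ricci solitons: the equation point of view*,
  manuscripta math. 127 (2008), Prop. 2.1. [EminentiLanaveMantegazza2008]
* P. Topping, *Lectures on the Ricci flow*, LMS Lecture Note Series 325, CUP 2006, §2.4,
  Prop. 2.4.1; §3.2, Prop. 3.2.10 and its proof. [Topping2006]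
-/

noncomputable section

set_option maxSynthPendingDepth 3

open Set Filter ContinuousLinearMap Module
open scoped Topology ContDiff

namespace Literature.Geometry.Lorentzian

namespace MetricCoord

variable {E : Type*} [NormedAddCommGroup E] [NormedSpace ℝ E] [FiniteDimensional ℝ E]
  [CompleteSpace E] {G : E → E →L[ℝ] E →L[ℝ] ℝ} {V : Set E} {x : E} {f : E → ℝ} {lam : ℝ}

/-! ### `∇_v R` through the second Bianchi identity -/

omit [FiniteDimensional ℝ E] in
/-- **`∇_v R` through the second Bianchi identity**: for every vector `v`,
`G((∇_v R)(X,Y)Z, W) = G(v, (∇_Y R)(Z,W)X) − G(v, (∇_X R)(Z,W)Y)` (the second Bianchi identity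
`(∇_v R)(X,Y) + (∇_X R)(Y,v) + (∇_Y R)(v,X) = 0` and the pair symmetry of `∇R`). For `v = ∇f`
the right-hand side is the first-order part of `ΔRm` on a gradient soliton, i.e. the drift term
`∇_{∇f} Rm` of `Δ_f Rm` (Munteanu–Wang 2015, §1, (id)). [cite: ONeill1983, Ch. 3, Prop. 3.37]
[cite: MunteanuWang2015, §1, (id) and proof of Thm. 1.4] -/
theorem IsMetricOn.apply_covRiemAt_eq_of_bianchi (hG : IsMetricOn G V) (hx : x ∈ V)
    (v X Y Z W : E) :
    G x (covRiemAt G x v X Y Z) W =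
      G x v (covRiemAt G x Y Z W X) - G x v (covRiemAt G x X Z W Y) := by
  have hs := hG.symm x hx
  have hc := hG.covRiemAt_cyclic hx v X Y
  have h0 := congrArg (fun T : E →L[ℝ] E ↦ G x (T Z) W) hc
  simp only [_root_.add_apply, map_add, _root_.zero_apply, map_zero] at h0
  have h1 : G x (covRiemAt G x X Y v Z) W = G x v (covRiemAt G x X Z W Y) := by
    rw [hG.apply_covRiemAt_pair_comm hx X Y v Z W, hs _ v]
  have h2 : G x (covRiemAt G x Y v X Z) W = -G x v (covRiemAt G x Y Z W X) := by
    rw [apply_covRiemAt_swap₁₂, hG.apply_covRiemAt_pair_comm hx Y X v Z W, hs _ v]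
  linarith

/-! ### `Δ_f Rm = 2λ Rm + Rm ∗ Rm + Ric ∗ Rm` (Munteanu–Wang 2015, (id)) -/

/-- **The Laplacian of the curvature tensor of a gradient Ricci soliton, in coordinates**
(Munteanu–Wang 2015, §1, formula (id): `Δ_f Rm = Rm + Rm ∗ Rm` for `λ = ½`; Eminenti–La Nave–
Mantegazza 2008, Prop. 2.1; Petersen–Wylie 2009, Lemma 2.1). For metric components with
`Ric + Hess f = λ G` on `V`, at `x ∈ V`, for all `X, Y, Z, W` and any basis `b`:
`G((ΔR)(X,Y)Z, W) = G((∇_{♯Df}R)(X,Y)Z, W) + 2λ G(R(X,Y)Z, W) + Ric(X, R(Z,W)Y) − Ric(Y, R(Z,W)X)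
   − Q(X,Y,Z,W) + Q(Y,X,Z,W)`,
with `ΔR = lapRiemAt` the rough Laplacian and `Q = quadRiemAt` the quadratic term of Topping's
Prop. 2.4.1 (`apply_lapRiemAt`). Proof: in `apply_lapRiemAt` the four `∇²Ric` terms are
`Hess f(Y, R(Z,W)X) − Hess f(X, R(Z,W)Y) + Df((∇_Y R)(Z,W)X) − Df((∇_X R)(Z,W)Y)`
(`cov₃At_cov₂At_ricAt_sub_of_soliton`); the `Df` terms are `G((∇_{♯Df}R)(X,Y)Z, W)`
(`apply_covRiemAt_eq_of_bianchi`) and `Hess f = λG − Ric` with pair symmetry gives the rest.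
[cite: MunteanuWang2015, §1, (id) and proof of Thm. 1.4]
[cite: EminentiLanaveMantegazza2008, Prop. 2.1] -/
theorem IsMetricOn.apply_lapRiemAt_of_soliton {ι : Type*} [Fintype ι] (b : Basis ι ℝ E)
    (hG : IsMetricOn G V) (hx : x ∈ V) (hf : ContDiffOn ℝ ∞ f V)
    (hsol : ∀ y ∈ V, ∀ v w, ricAt G y v w + hessAt G f y v w = lam * G y v w) (X Y Z W : E) :
    G x (lapRiemAt G b x X Y Z) W =
      G x (covRiemAt G x (sharpAt G x (fderiv ℝ f x)) X Y Z) W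
        + 2 * lam * G x (riemAt G x X Y Z) W
        + (ricAt G x X (riemAt G x Z W Y) - ricAt G x Y (riemAt G x Z W X))
        - quadRiemAt G b x X Y Z W + quadRiemAt G b x Y X Z W := by
  have hi := hG.isInvertible x hx
  have hs := hG.symm x hx
  set v := sharpAt G x (fderiv ℝ f x) with hv
  have hDf : ∀ U, fderiv ℝ f x U = G x v U := fun U ↦ (apply_sharpAt_apply hi _ U).symm
  have hH : ∀ u w, hessAt G f x u w = lam * G x u w - ricAt G x u w := by
    intro u w
    have h := hsol x hx u w
    linarith
  rw [hG.apply_lapRiemAt b hx]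
  have e1 := hG.cov₃At_cov₂At_ricAt_sub_of_soliton hx hf hsol X Z W Y
  have e2 := hG.cov₃At_cov₂At_ricAt_sub_of_soliton hx hf hsol Y Z W X
  have hB := hG.apply_covRiemAt_eq_of_bianchi hx v X Y Z W
  have hH1 := hH X (riemAt G x Z W Y)
  have hH2 := hH Y (riemAt G x Z W X)
  have hD1 := hDf (covRiemAt G x X Z W Y)
  have hD2 := hDf (covRiemAt G x Y Z W X)
  have r1 : G x X (riemAt G x Z W Y) = -G x (riemAt G x X Y Z) W := by
    rw [hs X, hG.apply_riemAt_swap hx Z W X Y, hG.apply_riemAt_pair_comm hx Z W X Y]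
  have r2 : G x Y (riemAt G x Z W X) = G x (riemAt G x X Y Z) W := by
    rw [hs Y, hG.apply_riemAt_pair_comm hx Z W X Y]
  linear_combination -e1 + e2 - hH1 + hH2 - hD1 + hD2 - hB - lam * r1 + lam * r2

/-! ### `|∇Rm|²` and the Kato inequality in an orthonormal frame -/

section Frame

variable {ι : Type*} [Fintype ι] [DecidableEq ι]
  (e : Basis ι ℝ E) (he : ∀ i j, G x (e i) (e j) = if i = j then 1 else 0)
include he

omit [CompleteSpace E] [DecidableEq ι] he in
/-- The Cauchy–Schwarz inequality for a fourfold sum: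
`(Σ R S)² ≤ (Σ R²)(Σ S²)`. [folklore] -/
theorem sq_sum₄_mul_le (R S : ι → ι → ι → ι → ℝ) :
    (∑ a, ∑ c, ∑ i, ∑ j, R a c i j * S a c i j) ^ 2 ≤
      (∑ a, ∑ c, ∑ i, ∑ j, R a c i j ^ 2) * ∑ a, ∑ c, ∑ i, ∑ j, S a c i j ^ 2 := by
  have h := Finset.sum_mul_sq_le_sq_mul_sq (Finset.univ : Finset (ι × ι × ι × ι))
    (fun p ↦ R p.1 p.2.1 p.2.2.1 p.2.2.2) (fun p ↦ S p.1 p.2.1 p.2.2.1 p.2.2.2)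
  simpa only [Fintype.sum_prod_type] using h

/-- **`|∇Rm|²` in an orthonormal frame**: the contraction
`Σ g^{kl} g^{aa'} g^{cc'} tr((∇_{b_k}R)(b_a,b_c) (∇_{b_l}R)(b_{a'},b_{c'}))` of `lapAt_rmNormSqAt`,
taken in a `G x`-orthonormal basis `e`, equals `−Σ_{kacij} G((∇_{e_k}R)(e_a,e_c)e_i, e_j)² = −|∇Rm|²`
(the endomorphisms `(∇_{e_k}R)(e_a,e_c)` are `G`-skew, `tr(A²) = −Σ A_{ij}²`).
[cite: Topping2006, Prop. 3.2.10 (proof)] -/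
theorem IsMetricOn.sum_ginv_traceCLM_covRiemAt_eq (hG : IsMetricOn G V) (hx : x ∈ V) :
    ∑ k, ∑ l, ginv G e x k l * ∑ a, ∑ a', ∑ c, ∑ c', ginv G e x a a' * ginv G e x c c' *
        traceCLM E ((covRiemAt G x (e k) (e a) (e c)).comp (covRiemAt G x (e l) (e a') (e c'))) =
      -∑ k, ∑ a, ∑ c, ∑ i, ∑ j, (G x (covRiemAt G x (e k) (e a) (e c) (e i)) (e j)) ^ 2 := by
  have hi := hG.isInvertible x hx
  rw [sum_ginv_collapse e he hi, ← Finset.sum_neg_distrib]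
  refine Finset.sum_congr rfl fun k _ ↦ ?_
  rw [sum_ginv_ginv_collapse e he hi, ← Finset.sum_neg_distrib]
  refine Finset.sum_congr rfl fun a _ ↦ ?_
  rw [← Finset.sum_neg_distrib]
  refine Finset.sum_congr rfl fun c _ ↦ ?_
  rw [traceCLM_eq_sum_of_orthonormal e he, ← Finset.sum_neg_distrib]
  refine Finset.sum_congr rfl fun i _ ↦ ?_
  rw [ContinuousLinearMap.comp_apply, apply_comp_of_orthonormal e he, ← Finset.sum_neg_distrib]
  refine Finset.sum_congr rfl fun j _ ↦ ?_
  rw [hG.apply_covRiemAt_swap hx (e k) (e a) (e c) (e i) (e j)]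
  ring

/-- **`d|Rm|²(e_k) = 2⟨∇_{e_k} Rm, Rm⟩` in an orthonormal frame**:
`∂_{e_k} |Rm|² = 2 Σ_{acij} G(R(e_a,e_c)e_i, e_j) G((∇_{e_k}R)(e_a,e_c)e_i, e_j)`.
[cite: Topping2006, Prop. 3.2.10 (proof)] -/
theorem IsMetricOn.fderiv_rmNormSqAt_frame (hG : IsMetricOn G V) (hx : x ∈ V) (k : ι) :
    fderiv ℝ (rmNormSqAt G) x (e k) = 2 * ∑ a, ∑ c, ∑ i, ∑ j,
      G x (riemAt G x (e a) (e c) (e i)) (e j) * G x (covRiemAt G x (e k) (e a) (e c) (e i)) (e j) := by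
  have hi := hG.isInvertible x hx
  have hac : ∀ a c, traceCLM E ((covRiemAt G x (e k) (e a) (e c)).comp (riemAt G x (e a) (e c)))
      + traceCLM E ((riemAt G x (e a) (e c)).comp (covRiemAt G x (e k) (e a) (e c))) =
      -(2 * ∑ i, ∑ j, G x (riemAt G x (e a) (e c) (e i)) (e j)
        * G x (covRiemAt G x (e k) (e a) (e c) (e i)) (e j)) := by
    intro a c
    rw [traceCLM_comp_comm (riemAt G x (e a) (e c)) (covRiemAt G x (e k) (e a) (e c)), ← two_mul,
      traceCLM_eq_sum_of_orthonormal e he, Finset.mul_sum, Finset.mul_sum, ← Finset.sum_neg_distrib]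
    refine Finset.sum_congr rfl fun i _ ↦ ?_
    rw [ContinuousLinearMap.comp_apply, apply_comp_of_orthonormal e he, Finset.mul_sum, Finset.mul_sum,
      ← Finset.sum_neg_distrib]
    refine Finset.sum_congr rfl fun j _ ↦ ?_
    rw [hG.apply_covRiemAt_swap hx (e k) (e a) (e c) (e i) (e j)]
    ring
  rw [hG.fderiv_rmNormSqAt e hx (e k), sum_ginv_ginv_collapse e he hi]
  simp only [hac, Finset.sum_neg_distrib, neg_neg, Finset.mul_sum]

/-- **Kato's inequality for `Rm`, squared, in coordinates** (Munteanu–Wang 2015, proof of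
Thm. 1.4: `|∇|Rm|| ≤ |∇Rm|`, used as `|∇|Rm|²|² ≤ 4|Rm|²|∇Rm|²`): in a `G x`-orthonormal basis `e`,
`|∇|Rm|²|²_G ≤ 4 |Rm|² Σ_{kacij} G((∇_{e_k}R)(e_a,e_c)e_i, e_j)²` (the differential
`d|Rm|²(e_k) = 2⟨∇_{e_k}Rm, Rm⟩`, `fderiv_rmNormSqAt_frame`, and the Cauchy–Schwarz inequality).
[cite: MunteanuWang2015, §1, (id) and proof of Thm. 1.4] -/
theorem IsMetricOn.gradSqAt_rmNormSqAt_le (hG : IsMetricOn G V) (hx : x ∈ V) :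
    gradSqAt G (rmNormSqAt G) x ≤ 4 * rmNormSqAt G x *
      ∑ k, ∑ a, ∑ c, ∑ i, ∑ j, (G x (covRiemAt G x (e k) (e a) (e c) (e i)) (e j)) ^ 2 := by
  have hi := hG.isInvertible x hx
  -- `|∇u|² = Σ_k (du(e_k))²`
  have hgrad : gradSqAt G (rmNormSqAt G) x = ∑ k, (fderiv ℝ (rmNormSqAt G) x (e k)) ^ 2 := by
    rw [gradSqAt_apply]
    conv_lhs => rw [← sum_apply_smul_of_orthonormal e he (sharpAt G x (fderiv ℝ (rmNormSqAt G) x))]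
    rw [map_sum]
    refine Finset.sum_congr rfl fun k _ ↦ ?_
    rw [map_smul, smul_eq_mul, apply_sharpAt_apply hi, sq]
  rw [hgrad, Finset.mul_sum]
  refine Finset.sum_le_sum fun k _ ↦ ?_
  have hCS := sq_sum₄_mul_le (fun a c i j ↦ G x (riemAt G x (e a) (e c) (e i)) (e j))
    (fun a c i j ↦ G x (covRiemAt G x (e k) (e a) (e c) (e i)) (e j))
  beta_reduce at hCS
  rw [hG.fderiv_rmNormSqAt_frame e he hx k, hG.rmNormSqAt_eq_sum_sq e he hx]
  linarith

/-! ### The drift inequality `Δ_f|Rm|² ≥ 2|∇Rm|² + 4λ|Rm|² − C|Rm|³` -/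

/-- **Munteanu–Wang 2015, proof of Thm. 1.4, first display — the drift inequality for `|Rm|²` on a
gradient Ricci soliton, in coordinates.** For metric components with `Ric + Hess f = λG` on `V`,
at `x ∈ V`, in a `G x`-orthonormal basis `e` (so `G x` is positive definite):
`Δ|Rm|² − d|Rm|²(∇f) ≥ 2|∇Rm|² + 4λ|Rm|² − (16n⁶ + 4n⁷)|Rm|²√(|Rm|²)`, where
`|∇Rm|² = Σ_{kacij} G((∇_{e_k}R)(e_a,e_c)e_i, e_j)²`, `Δ = lapAt G`, `∇f = ♯Df` and
`n = card ι = dim E`; i.e. `Δ_f|Rm|² ≥ 2|∇Rm|² − c|Rm|³ + 4λ|Rm|²` (from (id); combined in print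
with Kato's inequality into `Δ_f|Rm| ≥ −c|Rm|²`). Proof as printed:
`Δ|Rm|² = 2⟨ΔRm, Rm⟩ + 2|∇Rm|²` (`lapAt_rmNormSqAt`), `d|Rm|²(∇f) = 2⟨∇_{∇f}Rm, Rm⟩`
(`fderiv_rmNormSqAt`), `ΔRm − ∇_{∇f}Rm = 2λRm + Ric ∗ Rm + Rm ∗ Rm` (`apply_lapRiemAt_of_soliton`),
and in the orthonormal frame every cubic term is bounded by a dimensional multiple of `|Rm|³`.
[cite: MunteanuWang2015, §1, (id) and proof of Thm. 1.4] -/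
theorem IsMetricOn.lapAt_rmNormSqAt_sub_fderiv_ge_of_soliton (hG : IsMetricOn G V) (hx : x ∈ V)
    (hf : ContDiffOn ℝ ∞ f V)
    (hsol : ∀ y ∈ V, ∀ v w, ricAt G y v w + hessAt G f y v w = lam * G y v w) :
    2 * ∑ k, ∑ a, ∑ c, ∑ i, ∑ j, (G x (covRiemAt G x (e k) (e a) (e c) (e i)) (e j)) ^ 2
        + 4 * lam * rmNormSqAt G x
        - (16 * (Fintype.card ι : ℝ) ^ 6 + 4 * (Fintype.card ι : ℝ) ^ 7)
          * (rmNormSqAt G x * Real.sqrt (rmNormSqAt G x))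
      ≤ lapAt G (rmNormSqAt G) x - fderiv ℝ (rmNormSqAt G) x (sharpAt G x (fderiv ℝ f x)) := by
  have hi := hG.isInvertible x hx
  have hs := hG.symm x hx
  -- notation and scalar facts
  set n : ℝ := (Fintype.card ι : ℝ) with hn
  set u := rmNormSqAt G x with hu
  set K := Real.sqrt u with hK
  have hu0 : 0 ≤ u := hG.rmNormSqAt_nonneg e he hx
  have hK0 : 0 ≤ K := Real.sqrt_nonneg _
  have hKsq : K ^ 2 = u := Real.sq_sqrt hu0
  have hK3 : K ^ 3 = u * K := by rw [pow_succ, hKsq]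
  -- component bounds
  have hRK : ∀ a c i j, |G x (riemAt G x (e a) (e c) (e i)) (e j)| ≤ K :=
    fun a c i j ↦ hG.abs_rm_le_sqrt e he hx a c i j
  have hRK' : ∀ a c i j, |G x (riemCLM G x (e a) (e c) (e i)) (e j)| ≤ K :=
    fun a c i j ↦ by rw [riemCLM_apply]; exact hRK a c i j
  have hRic : ∀ a c, |ricAt G x (e a) (e c)| ≤ n * K := fun a c ↦ abs_ricAt_le e he hRK a c
  have h1 : ∀ i p, |G x (e i) (e p)| ≤ 1 := fun i p ↦ by
    rw [he]; split_ifs <;> simp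
  -- (1) the Laplacian and the drift in the basis `e`
  rw [hG.lapAt_rmNormSqAt e hx, hG.fderiv_rmNormSqAt e hx _, hG.sum_ginv_traceCLM_covRiemAt_eq e he hx,
    sum_ginv_ginv_collapse e he hi, sum_ginv_ginv_collapse e he hi]
  set v := sharpAt G x (fderiv ℝ f x) with hv
  set N := ∑ k, ∑ a, ∑ c, ∑ i, ∑ j, (G x (covRiemAt G x (e k) (e a) (e c) (e i)) (e j)) ^ 2 with hN
  -- (2) the drift: `tr((∇_vR) R) + tr(R (∇_vR)) = 2 tr((∇_vR) R)`
  have hD : ∀ a c, traceCLM E ((covRiemAt G x v (e a) (e c)).comp (riemAt G x (e a) (e c)))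
      + traceCLM E ((riemAt G x (e a) (e c)).comp (covRiemAt G x v (e a) (e c))) =
      2 * traceCLM E ((covRiemAt G x v (e a) (e c)).comp (riemAt G x (e a) (e c))) := by
    intro a c
    rw [traceCLM_comp_comm (riemAt G x (e a) (e c)) (covRiemAt G x v (e a) (e c)), two_mul]
  -- (3) the soliton identity traced against `R(e_a,e_c)`
  set W := ∑ a, ∑ c, ∑ i,
      (ricAt G x (e a) (riemAt G x (riemAt G x (e a) (e c) (e i)) (e i) (e c))
        - ricAt G x (e c) (riemAt G x (riemAt G x (e a) (e c) (e i)) (e i) (e a))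
        - quadRiemAt G e x (e a) (e c) (riemAt G x (e a) (e c) (e i)) (e i)
        + quadRiemAt G e x (e c) (e a) (riemAt G x (e a) (e c) (e i)) (e i)) with hW
  have hkey : ∀ a c, traceCLM E ((lapRiemAt G e x (e a) (e c)).comp (riemAt G x (e a) (e c)))
      - traceCLM E ((covRiemAt G x v (e a) (e c)).comp (riemAt G x (e a) (e c))) =
      ∑ i, (2 * lam * G x (riemAt G x (e a) (e c) (riemAt G x (e a) (e c) (e i))) (e i)
        + (ricAt G x (e a) (riemAt G x (riemAt G x (e a) (e c) (e i)) (e i) (e c))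
          - ricAt G x (e c) (riemAt G x (riemAt G x (e a) (e c) (e i)) (e i) (e a))
          - quadRiemAt G e x (e a) (e c) (riemAt G x (e a) (e c) (e i)) (e i)
          + quadRiemAt G e x (e c) (e a) (riemAt G x (e a) (e c) (e i)) (e i))) := by
    intro a c
    rw [traceCLM_eq_sum_of_orthonormal e he, traceCLM_eq_sum_of_orthonormal e he,
      ← Finset.sum_sub_distrib]
    refine Finset.sum_congr rfl fun i _ ↦ ?_
    rw [ContinuousLinearMap.comp_apply, ContinuousLinearMap.comp_apply,
      hG.apply_lapRiemAt_of_soliton e hx hf hsol]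
    ring
  -- `Σ_{aci} G(R(a,c) R(a,c)e_i, e_i) = −|Rm|²`
  have hRR : ∑ a, ∑ c, ∑ i, G x (riemAt G x (e a) (e c) (riemAt G x (e a) (e c) (e i))) (e i) = -u := by
    rw [hu, rmNormSqAt_eq_sum e, sum_ginv_ginv_collapse e he hi, neg_neg]
    refine Finset.sum_congr rfl fun a _ ↦ Finset.sum_congr rfl fun c _ ↦ ?_
    rw [traceCLM_eq_sum_of_orthonormal e he]
    simp only [ContinuousLinearMap.comp_apply]
  have hsum : ∑ a, ∑ c, traceCLM E ((lapRiemAt G e x (e a) (e c)).comp (riemAt G x (e a) (e c))) =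
      ∑ a, ∑ c, traceCLM E ((covRiemAt G x v (e a) (e c)).comp (riemAt G x (e a) (e c)))
        - 2 * lam * u + W := by
    have hkey' : ∀ a c, traceCLM E ((lapRiemAt G e x (e a) (e c)).comp (riemAt G x (e a) (e c))) =
        traceCLM E ((covRiemAt G x v (e a) (e c)).comp (riemAt G x (e a) (e c)))
          + 2 * lam * ∑ i, G x (riemAt G x (e a) (e c) (riemAt G x (e a) (e c) (e i))) (e i)
          + ∑ i, (ricAt G x (e a) (riemAt G x (riemAt G x (e a) (e c) (e i)) (e i) (e c))
            - ricAt G x (e c) (riemAt G x (riemAt G x (e a) (e c) (e i)) (e i) (e a))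
            - quadRiemAt G e x (e a) (e c) (riemAt G x (e a) (e c) (e i)) (e i)
            + quadRiemAt G e x (e c) (e a) (riemAt G x (e a) (e c) (e i)) (e i)) := by
      intro a c
      have h := hkey a c
      rw [Finset.sum_add_distrib, ← Finset.mul_sum] at h
      linarith
    simp only [hkey', Finset.sum_add_distrib, ← Finset.mul_sum, hRR, hW]
    ring
  have hDsum : ∑ a, ∑ c, (traceCLM E ((covRiemAt G x v (e a) (e c)).comp (riemAt G x (e a) (e c)))
      + traceCLM E ((riemAt G x (e a) (e c)).comp (covRiemAt G x v (e a) (e c)))) =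
      2 * ∑ a, ∑ c, traceCLM E ((covRiemAt G x v (e a) (e c)).comp (riemAt G x (e a) (e c))) := by
    simp only [hD, Finset.mul_sum]
  -- (4) the cubic terms: `|W| ≤ (2n⁷ + 8n⁶) K³`
  have hWabs : |W| ≤ (2 * n ^ 7 + 8 * n ^ 6) * K ^ 3 := by
    -- the endomorphisms `Q_k` of the quadratic term
    have hQ : ∀ a c k i j, |G x (((riemAt G x (e k) (e a)).comp (riemAt G x (e c) (e k))
        - (riemAt G x (e c) (e k)).comp (riemAt G x (e k) (e a))
        - riemAt G x (riemAt G x (e k) (e a) (e c)) (e k)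
        - riemAt G x (e c) (riemAt G x (e k) (e a) (e k))) (e i)) (e j)| ≤ 4 * (n * (K * K)) := by
      intro a c k i j
      have b1 : |G x ((riemAt G x (e k) (e a)).comp (riemAt G x (e c) (e k)) (e i)) (e j)|
          ≤ n * (K * K) := by
        rw [ContinuousLinearMap.comp_apply]; exact abs_apply_comp_le e he (hRK k a) (hRK c k) i j
      have b2 : |G x ((riemAt G x (e c) (e k)).comp (riemAt G x (e k) (e a)) (e i)) (e j)|
          ≤ n * (K * K) := by
        rw [ContinuousLinearMap.comp_apply]; exact abs_apply_comp_le e he (hRK c k) (hRK k a) i j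
      have b3 : |G x (riemAt G x (riemAt G x (e k) (e a) (e c)) (e k) (e i)) (e j)| ≤ n * (K * K) := by
        have h := abs_apply_riem_left_le e he (R := riemCLM G x) hRK' (hRK k a c) k i j
        simpa only [riemCLM_apply] using h
      have b4 : |G x (riemAt G x (e c) (riemAt G x (e k) (e a) (e k)) (e i)) (e j)| ≤ n * (K * K) := by
        have h := abs_apply_riem_right_le e he (R := riemCLM G x) hRK' (hRK k a k) c i j
        simpa only [riemCLM_apply] using h
      simp only [_root_.sub_apply, map_sub]
      have e1 := abs_sub (G x ((riemAt G x (e k) (e a)).comp (riemAt G x (e c) (e k)) (e i)) (e j)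
        - G x ((riemAt G x (e c) (e k)).comp (riemAt G x (e k) (e a)) (e i)) (e j)
        - G x (riemAt G x (riemAt G x (e k) (e a) (e c)) (e k) (e i)) (e j))
        (G x (riemAt G x (e c) (riemAt G x (e k) (e a) (e k)) (e i)) (e j))
      have e2 := abs_sub (G x ((riemAt G x (e k) (e a)).comp (riemAt G x (e c) (e k)) (e i)) (e j)
        - G x ((riemAt G x (e c) (e k)).comp (riemAt G x (e k) (e a)) (e i)) (e j))
        (G x (riemAt G x (riemAt G x (e k) (e a) (e c)) (e k) (e i)) (e j))
      have e3 := abs_sub (G x ((riemAt G x (e k) (e a)).comp (riemAt G x (e c) (e k)) (e i)) (e j))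
        (G x ((riemAt G x (e c) (e k)).comp (riemAt G x (e k) (e a)) (e i)) (e j))
      linarith
    -- the quadratic terms
    have hquad : ∀ a c d d' i, |quadRiemAt G e x (e d) (e d') (riemAt G x (e a) (e c) (e i)) (e i)|
        ≤ n * (n * (K * (4 * (n * (K * K))))) := by
      intro a c d d' i
      rw [quadRiemAt_of_orthonormal e he hi]
      refine (Finset.abs_sum_le_sum_abs _ _).trans ?_
      calc ∑ k, |G x (((riemAt G x (e k) (e d)).comp (riemAt G x (e d') (e k))
            - (riemAt G x (e d') (e k)).comp (riemAt G x (e k) (e d))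
            - riemAt G x (riemAt G x (e k) (e d) (e d')) (e k)
            - riemAt G x (e d') (riemAt G x (e k) (e d) (e k))) (riemAt G x (e a) (e c) (e i))) (e i)|
          ≤ ∑ _k : ι, n * (K * (4 * (n * (K * K)))) :=
            Finset.sum_le_sum fun k _ ↦ abs_apply_vec_le e he (hQ d d' k) (hRK a c i) i
        _ = n * (n * (K * (4 * (n * (K * K))))) := by
            simp only [Finset.sum_const, Finset.card_univ, nsmul_eq_mul, hn]
    -- the Ricci terms
    have hw : ∀ a c i d p, |G x (riemAt G x (riemAt G x (e a) (e c) (e i)) (e i) (e d)) (e p)|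
        ≤ n * (K * K) := by
      intro a c i d p
      have h := abs_apply_riem_left_le e he (R := riemCLM G x) hRK' (hRK a c i) i d p
      simpa only [riemCLM_apply] using h
    have hric : ∀ a c i d d', |ricAt G x (e d) (riemAt G x (riemAt G x (e a) (e c) (e i)) (e i) (e d'))|
        ≤ n * (n * (1 * (n * (K * K) * (n * K)))) :=
      fun a c i d d' ↦ abs_bilin_le e he (β := ricAt G x) hRic (h1 d) (hw a c i d')
    have hterm : ∀ a c i, |ricAt G x (e a) (riemAt G x (riemAt G x (e a) (e c) (e i)) (e i) (e c))
        - ricAt G x (e c) (riemAt G x (riemAt G x (e a) (e c) (e i)) (e i) (e a))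
        - quadRiemAt G e x (e a) (e c) (riemAt G x (e a) (e c) (e i)) (e i)
        + quadRiemAt G e x (e c) (e a) (riemAt G x (e a) (e c) (e i)) (e i)|
        ≤ (2 * n ^ 4 + 8 * n ^ 3) * K ^ 3 := by
      intro a c i
      have r1 := hric a c i a c
      have r2 := hric a c i c a
      have q1 := hquad a c a c i
      have q2 := hquad a c c a i
      have e1 := abs_add_le (ricAt G x (e a) (riemAt G x (riemAt G x (e a) (e c) (e i)) (e i) (e c))
        - ricAt G x (e c) (riemAt G x (riemAt G x (e a) (e c) (e i)) (e i) (e a))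
        - quadRiemAt G e x (e a) (e c) (riemAt G x (e a) (e c) (e i)) (e i))
        (quadRiemAt G e x (e c) (e a) (riemAt G x (e a) (e c) (e i)) (e i))
      have e2 := abs_sub (ricAt G x (e a) (riemAt G x (riemAt G x (e a) (e c) (e i)) (e i) (e c))
        - ricAt G x (e c) (riemAt G x (riemAt G x (e a) (e c) (e i)) (e i) (e a)))
        (quadRiemAt G e x (e a) (e c) (riemAt G x (e a) (e c) (e i)) (e i))
      have e3 := abs_sub (ricAt G x (e a) (riemAt G x (riemAt G x (e a) (e c) (e i)) (e i) (e c)))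
        (ricAt G x (e c) (riemAt G x (riemAt G x (e a) (e c) (e i)) (e i) (e a)))
      have hpoly : n * (n * (1 * (n * (K * K) * (n * K)))) + n * (n * (1 * (n * (K * K) * (n * K))))
          + n * (n * (K * (4 * (n * (K * K))))) + n * (n * (K * (4 * (n * (K * K)))))
          = (2 * n ^ 4 + 8 * n ^ 3) * K ^ 3 := by ring
      linarith
    rw [hW]
    refine (Finset.abs_sum_le_sum_abs _ _).trans ?_
    calc ∑ a, |∑ c, ∑ i, (ricAt G x (e a) (riemAt G x (riemAt G x (e a) (e c) (e i)) (e i) (e c))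
          - ricAt G x (e c) (riemAt G x (riemAt G x (e a) (e c) (e i)) (e i) (e a))
          - quadRiemAt G e x (e a) (e c) (riemAt G x (e a) (e c) (e i)) (e i)
          + quadRiemAt G e x (e c) (e a) (riemAt G x (e a) (e c) (e i)) (e i))|
        ≤ ∑ _a : ι, ∑ _c : ι, ∑ _i : ι, (2 * n ^ 4 + 8 * n ^ 3) * K ^ 3 :=
          Finset.sum_le_sum fun a _ ↦ (Finset.abs_sum_le_sum_abs _ _).trans
            (Finset.sum_le_sum fun c _ ↦ (Finset.abs_sum_le_sum_abs _ _).trans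
              (Finset.sum_le_sum fun i _ ↦ hterm a c i))
      _ = (2 * n ^ 7 + 8 * n ^ 6) * K ^ 3 := by
          simp only [Finset.sum_const, Finset.card_univ, nsmul_eq_mul, hn]; ring
  -- (5) conclude
  rw [hDsum, hsum]
  have hW' : |W| ≤ (2 * n ^ 7 + 8 * n ^ 6) * (u * K) := by rw [← hK3]; exact hWabs
  have hWle := le_abs_self W
  nlinarith [hW', hWle]

end Frame

end MetricCoord

end Literature.Geometry.Lorentzian

end
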